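import Summits.CriticalPhenomena.PercolationContinuityZ3.Theorems.PercNearOneGluingNoHeavyLowerTailStarSetWordDesignations
import Summits.CriticalPhenomena.PercolationContinuityZ3.Theorems.PercNearOneGluingNoHeavyLowerTailStarSetWordCaps
import Summits.CriticalPhenomena.PercolationContinuityZ3.Theorems.PercNearOneGluingNoHeavyLowerTailStarSetOmegaCliques
import HarnessLib

/-!
# `NoHeavyLowerTail` (stmt-CriticalPhenomena-4575) — the pool words of the residual bound are class-words, I (blueprint §G4)

Support file (prover `prim-gen-swap` gen 15; `--supports stmt-CriticalPhenomena-4575`).  No definitions, no named facts, no sorries.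

The explicit pool words of `StarSet.residual_pool_inst` are bounded by the capacities `C_T` of their class-sets: the SELF words
`(X→e, J→s, dom X ē→ē)` of the group entries by `C_{{X, J, dom X ē}}`, the SELF′ words `(X→ē, J→s, I₀→q₀)` of the flagged entries by
`C_{{X, J, I₀}}`, the SELF_I words `(X→a, I₀→q₀, dom X a→u)` of the `I₀`-hubs by `C_{{X, I₀, dom X a}}` and the CROSS_I words
`(X→a_X, Y→a_Y, I₀→q₀)` by `C_{{X, Y, I₀}}` — each designation is valid (`one_word_le_cap`) and each word map is injective into class-sets.

* `StarSet.pool_words_self_le` (the group entries; part II has the `I₀`-group words).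
-/

namespace Summit.CriticalPhenomena.PercolationContinuityZ3.Theorems

open Finset
open scoped BigOperators Classical

namespace StarSet

variable {ι V : Type*} [Fintype ι] [LinearOrder ι] [DecidableEq V]

/-- **SELF and SELF′ words of the group entries are bounded by the capacities of their class-sets.**  Units `u ∈ Ug` as in
`residual_pool_inst` (hub `u.2`, forest partner `Jf u`, ports `ef u`, `ēf u`). -/
theorem pool_words_self_le (P P' : ι → V) (hPP' : ∀ X, P X ≠ P' X)
    (hinj : Function.Injective fun X => (s(P X, P' X) : Sym2 V)) (r : V) (F : Finset ι)
    (O : ι → V → ℝ) (hO0 : ∀ X d, 0 ≤ O X d) (dom : ι → V → ι)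
    (hdom : ∀ X ∉ F, ∀ d, (P X = d ∨ P' X = d) →
      dom X d ∈ F ∧ (P (dom X d) = d ∨ P' (dom X d) = d) ∧
        (∀ u, (P (dom X d) = u ∨ P' (dom X d) = u) → (P X = u ∨ P' X = u) → u = d))
    (I₀ : ι)
    (Ug : Finset (Finset ι × ι)) (Jf : Finset ι × ι → ι) (ef ēf : Finset ι × ι → V)
    (hUg : ∀ u ∈ Ug, u.2 ∈ u.1 ∧ u.2 ∉ F ∧ (P u.2 ≠ r ∧ P' u.2 ≠ r) ∧ Jf u ∈ u.1 ∧ Jf u ∈ F ∧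
      (P (Jf u) ≠ r ∧ P' (Jf u) ≠ r) ∧ Jf u ≠ I₀ ∧
      ((P u.2 = ef u ∧ P' u.2 = ēf u) ∨ (P u.2 = ēf u ∧ P' u.2 = ef u)) ∧ (P (Jf u) = ef u ∨ P' (Jf u) = ef u) ∧
      ¬ (P (Jf u) = ēf u ∨ P' (Jf u) = ēf u) ∧ (P (dom u.2 (ēf u)) = r ∨ P' (dom u.2 (ēf u)) = r) ∧
      ¬ (P' (dom u.2 (ēf u)) = r ∧ Jf u = dom u.2 (ef u)) ∧
      (∀ K ∈ u.1, K ≠ u.2 → K ≠ Jf u → (P K = r ∨ P' K = r)) ∧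
      (∀ Y ∈ u.1, P Y = P u.2 ∨ P Y = P' u.2 ∨ P' Y = P u.2 ∨ P' Y = P' u.2)) :
    ∑ J ∈ Ug.image Jf, ∑ X ∈ (Ug.filter (fun u => Jf u = J)).image Prod.snd,
        (O X (if (P X = P J ∨ P X = P' J) then P X else P' X) * O J (if P J = (if (P X = P J ∨ P X = P' J) then P X else P' X) then P' J else P J)
              * O (dom X (if (P X = P J ∨ P X = P' J) then P' X else P X)) (if (P X = P J ∨ P X = P' J) then P' X else P X) +
            (if (((P X = P I₀ ∨ P' X = P I₀) ∧ I₀ ∈ F ∧ P' I₀ = r) ∧ dom X (if (P X = P J ∨ P X = P' J) then P' X else P X) ≠ I₀)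
                  then O X (if (P X = P J ∨ P X = P' J) then P' X else P X) * O J (if P J = (if (P X = P J ∨ P X = P' J) then P X else P' X)
                  then P' J else P J) * O I₀ (P I₀) else 0)) ≤
      ∑ T ∈ Ug.image (fun u => ({u.2, Jf u, dom u.2 (ēf u)} : Finset ι)), (∑ δ ∈ (univ : Finset (ι → Bool)).filter (fun δ => (∀ K ∉ T, δ K = false) ∧
            3 ≤ (T.image fun K => if δ K then P K else P' K).card ∧ r ∉ T.image fun K => if δ K then P K else P' K),
          ∏ K ∈ T, O K (if δ K then P K else P' K)) +
      ∑ T ∈ (Ug.filter (fun u => ((P u.2 = P I₀ ∨ P' u.2 = P I₀) ∧ I₀ ∈ F ∧ P' I₀ = r) ∧ dom u.2 (ēf u) ≠ I₀)).image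
          (fun u => ({u.2, Jf u, I₀} : Finset ι)), (∑ δ ∈ (univ : Finset (ι → Bool)).filter (fun δ => (∀ K ∉ T, δ K = false) ∧
            3 ≤ (T.image fun K => if δ K then P K else P' K).card ∧ r ∉ T.image fun K => if δ K then P K else P' K),
          ∏ K ∈ T, O K (if δ K then P K else P' K)) := by
  set eJ : ι → ι → V := fun J X => (if (P X = P J ∨ P X = P' J) then P X else P' X) with heJ
  set ēJ : ι → ι → V := fun J X => (if (P X = P J ∨ P X = P' J) then P' X else P X) with hēJ
  set sJ : ι → ι → V := fun J X => (if P J = (if (P X = P J ∨ P X = P' J) then P X else P' X) then P' J else P J) with hsJ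
  set C : Finset ι → ℝ := fun T => ∑ δ ∈ (univ : Finset (ι → Bool)).filter (fun δ => (∀ K ∉ T, δ K = false) ∧
      3 ≤ (T.image fun K => if δ K then P K else P' K).card ∧ r ∉ T.image fun K => if δ K then P K else P' K),
    ∏ K ∈ T, O K (if δ K then P K else P' K) with hC
  have hC0 : ∀ T, 0 ≤ C T := fun T => sum_nonneg fun δ _ => prod_nonneg fun K _ => hO0 _ _
  have hsel : ∀ u ∈ Ug, eJ (Jf u) u.2 = ef u ∧ ēJ (Jf u) u.2 = ēf u := by
    intro u hu
    obtain ⟨-, -, -, -, -, -, -, hX, hJe, hJē, -⟩ := hUg u hu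
    simp only [heJ, hēJ]
    rcases hX with ⟨h1, h2⟩ | ⟨h1, h2⟩
    · have hc : P u.2 = P (Jf u) ∨ P u.2 = P' (Jf u) := by
        rw [h1]; rcases hJe with h | h; exacts [Or.inl h.symm, Or.inr h.symm]
      rw [if_pos hc, if_pos hc]; exact ⟨h1, h2⟩
    · have hc : ¬ (P u.2 = P (Jf u) ∨ P u.2 = P' (Jf u)) := by
        rw [h1]; rintro (h | h); exacts [hJē (Or.inl h.symm), hJē (Or.inr h.symm)]
      rw [if_neg hc, if_neg hc]; exact ⟨h2, h1⟩
  have hsJ_spec : ∀ u ∈ Ug, (P (Jf u) = sJ (Jf u) u.2 ∨ P' (Jf u) = sJ (Jf u) u.2) ∧ sJ (Jf u) u.2 ≠ ef u := by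
    intro u hu
    have he := (hsel u hu).1
    simp only [hsJ]
    rw [show (if (P u.2 = P (Jf u) ∨ P u.2 = P' (Jf u)) then P u.2 else P' u.2) = eJ (Jf u) u.2 from rfl, he]
    by_cases h : P (Jf u) = ef u
    · rw [if_pos h]; exact ⟨Or.inr rfl, fun h' => hPP' (Jf u) (h.trans h'.symm)⟩
    · rw [if_neg h]; exact ⟨Or.inl rfl, h⟩
  -- the entries
  set E : Finset (ι × ι) := Ug.image (fun u => (Jf u, u.2)) with hE
  have hwit : ∀ p ∈ E, ∃ u ∈ Ug, Jf u = p.1 ∧ u.2 = p.2 := by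
    intro p hp
    obtain ⟨u, hu, rfl⟩ := mem_image.1 hp
    exact ⟨u, hu, rfl, rfl⟩
  have hsum : ∀ f : ι → ι → ℝ, ∑ J ∈ Ug.image Jf, ∑ X ∈ (Ug.filter (fun u => Jf u = J)).image Prod.snd, f J X =
      ∑ p ∈ E, f p.1 p.2 := by
    intro f
    refine (sum_finset_product (f := fun p : ι × ι => f p.1 p.2) E (Ug.image Jf)
      (fun J => (Ug.filter (fun u => Jf u = J)).image Prod.snd) (fun p => ?_)).symm
    constructor
    · intro hp
      obtain ⟨u, hu, hJ, hX⟩ := hwit p hp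
      exact ⟨mem_image.2 ⟨u, hu, hJ⟩, mem_image.2 ⟨u, mem_filter.2 ⟨hu, hJ⟩, hX⟩⟩
    · rintro ⟨-, hX⟩
      obtain ⟨u, hu, hX⟩ := mem_image.1 hX
      obtain ⟨huU, hJ⟩ := mem_filter.1 hu
      exact mem_image.2 ⟨u, huU, Prod.ext hJ hX⟩
  -- facts at an entry
  have hfacts : ∀ p ∈ E, p.2 ∉ F ∧ (P p.2 ≠ r ∧ P' p.2 ≠ r) ∧ p.1 ∈ F ∧ (P p.1 ≠ r ∧ P' p.1 ≠ r) ∧ p.1 ≠ I₀ ∧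
      ((P p.2 = eJ p.1 p.2 ∧ P' p.2 = ēJ p.1 p.2) ∨ (P p.2 = ēJ p.1 p.2 ∧ P' p.2 = eJ p.1 p.2)) ∧
      ¬ (P p.1 = ēJ p.1 p.2 ∨ P' p.1 = ēJ p.1 p.2) ∧ (P p.1 = sJ p.1 p.2 ∨ P' p.1 = sJ p.1 p.2) ∧ sJ p.1 p.2 ≠ eJ p.1 p.2 ∧
      (P (dom p.2 (ēJ p.1 p.2)) = r ∨ P' (dom p.2 (ēJ p.1 p.2)) = r) := by
    intro p hp
    obtain ⟨J, X⟩ := p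
    obtain ⟨u, hu, rfl, rfl⟩ := hwit _ hp
    obtain ⟨-, hXF, hXr, -, hJF, hJr, hJI, hX, -, hJē, hhot, -⟩ := hUg u hu
    obtain ⟨he, hē⟩ := hsel u hu
    obtain ⟨hs, hse⟩ := hsJ_spec u hu
    rw [← he] at hX hse; rw [← hē] at hX hJē hhot
    exact ⟨hXF, hXr, hJF, hJr, hJI, hX, hJē, hs, hse, hhot⟩
  have hport_r : ∀ (K : ι) (x : V), (P K ≠ r ∧ P' K ≠ r) → (P K = x ∨ P' K = x) → x ≠ r := by
    rintro K x hK (h | h)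
    · rw [← h]; exact hK.1
    · rw [← h]; exact hK.2
  -- the SELF word of an entry
  have hmain : ∀ p ∈ E, O p.2 (eJ p.1 p.2) * O p.1 (sJ p.1 p.2) * O (dom p.2 (ēJ p.1 p.2)) (ēJ p.1 p.2) ≤
      C ({p.2, p.1, dom p.2 (ēJ p.1 p.2)} : Finset ι) := by
    intro p hp
    obtain ⟨hXF, hXr, hJF, hJr, -, hXp, hJē, hJs, hse, hhot⟩ := hfacts p hp
    have heX : P p.2 = eJ p.1 p.2 ∨ P' p.2 = eJ p.1 p.2 := by rcases hXp with ⟨h, _⟩ | ⟨_, h⟩; exacts [Or.inl h, Or.inr h]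
    have hēX : P p.2 = ēJ p.1 p.2 ∨ P' p.2 = ēJ p.1 p.2 := by rcases hXp with ⟨_, h⟩ | ⟨h, _⟩; exacts [Or.inr h, Or.inl h]
    have heē : eJ p.1 p.2 ≠ ēJ p.1 p.2 := by
      rcases hXp with ⟨h1, h2⟩ | ⟨h1, h2⟩
      · rw [← h1, ← h2]; exact hPP' p.2
      · rw [← h1, ← h2]; exact (hPP' p.2).symm
    obtain ⟨hDF, hDē, -⟩ := hdom p.2 hXF _ hēX
    have hsē : sJ p.1 p.2 ≠ ēJ p.1 p.2 := by
      intro h; rw [h] at hJs; exact hJē hJs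
    have hJD : p.1 ≠ dom p.2 (ēJ p.1 p.2) := by
      intro h; rw [← h] at hhot; rcases hhot with h' | h'; exacts [hJr.1 h', hJr.2 h']
    have hXJ : p.2 ≠ p.1 := fun h => hXF (h ▸ hJF)
    have hXD : p.2 ≠ dom p.2 (ēJ p.1 p.2) := fun h => hXF (h ▸ hDF)
    exact one_word_le_cap P P' r O hO0 hXJ hXD hJD heX hJs hDē hse.symm heē hsē
      (hport_r _ _ hXr heX) (hport_r _ _ hJr hJs) (hport_r _ _ hXr hēX)
  -- the SELF′ word of a flagged entry
  have hextra : ∀ p ∈ E, ((P p.2 = P I₀ ∨ P' p.2 = P I₀) ∧ I₀ ∈ F ∧ P' I₀ = r) ∧ dom p.2 (ēJ p.1 p.2) ≠ I₀ →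
      O p.2 (ēJ p.1 p.2) * O p.1 (sJ p.1 p.2) * O I₀ (P I₀) ≤ C ({p.2, p.1, I₀} : Finset ι) := by
    intro p hp ⟨⟨hXq, hIF, hIr⟩, hDI⟩
    obtain ⟨hXF, hXr, hJF, hJr, hJI, hXp, hJē, hJs, hse, hhot⟩ := hfacts p hp
    have heX : P p.2 = eJ p.1 p.2 ∨ P' p.2 = eJ p.1 p.2 := by rcases hXp with ⟨h, _⟩ | ⟨_, h⟩; exacts [Or.inl h, Or.inr h]
    have hēX : P p.2 = ēJ p.1 p.2 ∨ P' p.2 = ēJ p.1 p.2 := by rcases hXp with ⟨_, h⟩ | ⟨h, _⟩; exacts [Or.inr h, Or.inl h]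
    obtain ⟨hDF, hDē, -⟩ := hdom p.2 hXF _ hēX
    have hsē : sJ p.1 p.2 ≠ ēJ p.1 p.2 := by
      intro h; rw [h] at hJs; exact hJē hJs
    have hqr : P I₀ ≠ r := fun h => hPP' I₀ (h.trans hIr.symm)
    -- `ē ≠ q₀`: otherwise `dom X ē` is the leaf class
    have hēq : ēJ p.1 p.2 ≠ P I₀ := by
      intro h
      apply hDI
      apply hinj
      simp only
      have hDr : P (dom p.2 (ēJ p.1 p.2)) = ēJ p.1 p.2 ∧ P' (dom p.2 (ēJ p.1 p.2)) = r ∨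
          P (dom p.2 (ēJ p.1 p.2)) = r ∧ P' (dom p.2 (ēJ p.1 p.2)) = ēJ p.1 p.2 := by
        rcases hDē with h1 | h1 <;> rcases hhot with h2 | h2
        · exact absurd (h1.symm.trans h2) (by rw [h]; exact hqr)
        · exact Or.inl ⟨h1, h2⟩
        · exact Or.inr ⟨h2, h1⟩
        · exact absurd (h1.symm.trans h2) (by rw [h]; exact hqr)
      rcases hDr with ⟨h1, h2⟩ | ⟨h1, h2⟩
      · rw [h1, h2, h, hIr]
      · rw [h1, h2, h, hIr]; exact Sym2.eq_swap
    -- `e = q₀`, so `s ≠ q₀`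
    have hsq : sJ p.1 p.2 ≠ P I₀ := by
      have heq : eJ p.1 p.2 = P I₀ := by
        rcases hXq with h | h <;> rcases hXp with ⟨h1, h2⟩ | ⟨h1, h2⟩
        · exact h1.symm.trans h
        · exact absurd (h1.symm.trans h) hēq
        · exact absurd (h2.symm.trans h) hēq
        · exact h2.symm.trans h
      rw [← heq]; exact hse
    have hXJ : p.2 ≠ p.1 := fun h => hXF (h ▸ hJF)
    have hXI : p.2 ≠ I₀ := fun h => hXF (h ▸ hIF)
    exact one_word_le_cap P P' r O hO0 hXJ hXI hJI hēX hJs (Or.inl rfl)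
      hsē.symm hēq hsq (hport_r _ _ hXr hēX) (hport_r _ _ hJr hJs) hqr
  -- injectivity of the word maps
  have hinjT : Set.InjOn (fun p : ι × ι => ({p.2, p.1, dom p.2 (ēJ p.1 p.2)} : Finset ι)) ↑E := by
    intro p hp p' hp' h
    dsimp only at h
    obtain ⟨hXF, -, hJF, hJr, -, hXp, -, -, -, hhot⟩ := hfacts p hp
    obtain ⟨hXF', -, hJF', hJr', -, hXp', -, -, -, hhot'⟩ := hfacts p' hp'
    have hēX' : P p'.2 = ēJ p'.1 p'.2 ∨ P' p'.2 = ēJ p'.1 p'.2 := by rcases hXp' with ⟨_, h⟩ | ⟨h, _⟩; exacts [Or.inr h, Or.inl h]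
    have hDF' := (hdom p'.2 hXF' _ hēX').1
    have h2 : p.2 = p'.2 := by
      have : p.2 ∈ ({p'.2, p'.1, dom p'.2 (ēJ p'.1 p'.2)} : Finset ι) := by rw [← h]; exact mem_insert_self _ _
      rcases mem_insert.1 this with h' | h'; · exact h'
      rcases mem_insert.1 h' with h' | h'; · exact absurd (h' ▸ hJF') hXF
      exact absurd ((mem_singleton.1 h') ▸ hDF') hXF
    have h1 : p.1 = p'.1 := by
      have : p.1 ∈ ({p'.2, p'.1, dom p'.2 (ēJ p'.1 p'.2)} : Finset ι) := by rw [← h]; exact mem_insert_of_mem (mem_insert_self _ _)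
      rcases mem_insert.1 this with h' | h'; · exact absurd (h' ▸ hJF) hXF'
      rcases mem_insert.1 h' with h' | h'; · exact h'
      rw [mem_singleton.1 h'] at hJr
      rcases hhot' with h'' | h''; exacts [absurd h'' hJr.1, absurd h'' hJr.2]
    exact Prod.ext h1 h2
  have hinjT' : Set.InjOn (fun p : ι × ι => ({p.2, p.1, I₀} : Finset ι))
      ↑(E.filter (fun p => ((P p.2 = P I₀ ∨ P' p.2 = P I₀) ∧ I₀ ∈ F ∧ P' I₀ = r) ∧ dom p.2 (ēJ p.1 p.2) ≠ I₀)) := by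
    intro p hp p' hp' h
    dsimp only at h
    obtain ⟨hp, ⟨⟨-, hIF, hIr⟩, -⟩⟩ := mem_filter.1 (mem_coe.1 hp)
    obtain ⟨hp', -⟩ := mem_filter.1 (mem_coe.1 hp')
    obtain ⟨hXF, -, hJF, hJr, -⟩ := hfacts p hp
    obtain ⟨hXF', -, hJF', hJr', -⟩ := hfacts p' hp'
    have h2 : p.2 = p'.2 := by
      have : p.2 ∈ ({p'.2, p'.1, I₀} : Finset ι) := by rw [← h]; exact mem_insert_self _ _
      rcases mem_insert.1 this with h' | h'; · exact h'
      rcases mem_insert.1 h' with h' | h'; · exact absurd (h' ▸ hJF') hXF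
      exact absurd ((mem_singleton.1 h') ▸ hIF) hXF
    have h1 : p.1 = p'.1 := by
      have : p.1 ∈ ({p'.2, p'.1, I₀} : Finset ι) := by rw [← h]; exact mem_insert_of_mem (mem_insert_self _ _)
      rcases mem_insert.1 this with h' | h'; · exact absurd (h' ▸ hJF) hXF'
      rcases mem_insert.1 h' with h' | h'; · exact h'
      rw [mem_singleton.1 h'] at hJr; exact absurd hIr hJr.2
    exact Prod.ext h1 h2
  -- assemble
  rw [hsum]
  have hsplit : ∀ p ∈ E, O p.2 (eJ p.1 p.2) * O p.1 (sJ p.1 p.2) * O (dom p.2 (ēJ p.1 p.2)) (ēJ p.1 p.2) +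
      (if ((P p.2 = P I₀ ∨ P' p.2 = P I₀) ∧ I₀ ∈ F ∧ P' I₀ = r) ∧ dom p.2 (ēJ p.1 p.2) ≠ I₀ then
        O p.2 (ēJ p.1 p.2) * O p.1 (sJ p.1 p.2) * O I₀ (P I₀) else 0) ≤
      C ({p.2, p.1, dom p.2 (ēJ p.1 p.2)} : Finset ι) +
        (if ((P p.2 = P I₀ ∨ P' p.2 = P I₀) ∧ I₀ ∈ F ∧ P' I₀ = r) ∧ dom p.2 (ēJ p.1 p.2) ≠ I₀ then
          C ({p.2, p.1, I₀} : Finset ι) else 0) := by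
    intro p hp
    refine add_le_add (hmain p hp) ?_
    split_ifs with hc
    · exact hextra p hp hc
    · exact le_rfl
  have h1 : ∑ p ∈ E, C ({p.2, p.1, dom p.2 (ēJ p.1 p.2)} : Finset ι) ≤
      ∑ T ∈ Ug.image (fun u => ({u.2, Jf u, dom u.2 (ēf u)} : Finset ι)), C T := by
    rw [← sum_image hinjT]
    refine sum_le_sum_of_subset_of_nonneg (fun T hT => ?_) fun T _ _ => hC0 T
    obtain ⟨p, hp, rfl⟩ := mem_image.1 hT
    obtain ⟨J, X⟩ := p
    obtain ⟨u, hu, rfl, rfl⟩ := hwit _ hp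
    exact mem_image.2 ⟨u, hu, by rw [← (hsel u hu).2]⟩
  have h2 : ∑ p ∈ E, (if ((P p.2 = P I₀ ∨ P' p.2 = P I₀) ∧ I₀ ∈ F ∧ P' I₀ = r) ∧ dom p.2 (ēJ p.1 p.2) ≠ I₀ then
        C ({p.2, p.1, I₀} : Finset ι) else 0) ≤
      ∑ T ∈ (Ug.filter (fun u => ((P u.2 = P I₀ ∨ P' u.2 = P I₀) ∧ I₀ ∈ F ∧ P' I₀ = r) ∧ dom u.2 (ēf u) ≠ I₀)).image
          (fun u => ({u.2, Jf u, I₀} : Finset ι)), C T := by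
    rw [← sum_filter, ← sum_image hinjT']
    refine sum_le_sum_of_subset_of_nonneg (fun T hT => ?_) fun T _ _ => hC0 T
    obtain ⟨p, hp, rfl⟩ := mem_image.1 hT
    obtain ⟨hpE, hc⟩ := mem_filter.1 hp
    obtain ⟨J, X⟩ := p
    obtain ⟨u, hu, rfl, rfl⟩ := hwit _ hpE
    have hc' : ((P u.2 = P I₀ ∨ P' u.2 = P I₀) ∧ I₀ ∈ F ∧ P' I₀ = r) ∧ dom u.2 (ēf u) ≠ I₀ := by
      rw [← (hsel u hu).2]; exact hc
    exact mem_image.2 ⟨u, mem_filter.2 ⟨hu, hc'⟩, rfl⟩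
  calc ∑ p ∈ E, (O p.2 (eJ p.1 p.2) * O p.1 (sJ p.1 p.2) * O (dom p.2 (ēJ p.1 p.2)) (ēJ p.1 p.2) +
        (if ((P p.2 = P I₀ ∨ P' p.2 = P I₀) ∧ I₀ ∈ F ∧ P' I₀ = r) ∧ dom p.2 (ēJ p.1 p.2) ≠ I₀ then
          O p.2 (ēJ p.1 p.2) * O p.1 (sJ p.1 p.2) * O I₀ (P I₀) else 0))
      ≤ ∑ p ∈ E, (C ({p.2, p.1, dom p.2 (ēJ p.1 p.2)} : Finset ι) +
          (if ((P p.2 = P I₀ ∨ P' p.2 = P I₀) ∧ I₀ ∈ F ∧ P' I₀ = r) ∧ dom p.2 (ēJ p.1 p.2) ≠ I₀ then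
            C ({p.2, p.1, I₀} : Finset ι) else 0)) := sum_le_sum hsplit
    _ = ∑ p ∈ E, C ({p.2, p.1, dom p.2 (ēJ p.1 p.2)} : Finset ι) +
          ∑ p ∈ E, (if ((P p.2 = P I₀ ∨ P' p.2 = P I₀) ∧ I₀ ∈ F ∧ P' I₀ = r) ∧ dom p.2 (ēJ p.1 p.2) ≠ I₀ then
            C ({p.2, p.1, I₀} : Finset ι) else 0) := sum_add_distrib
    _ ≤ _ := add_le_add h1 h2

end StarSet

end Summit.CriticalPhenomena.PercolationContinuityZ3.Theorems
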